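import Literature.AlgebraicGeometry.Motives.SeesawChartSections
import HarnessLib

/-!
# The RELATIVE seesaw closed subscheme, chart vocabulary over a ring base: test algebras, `H⁰(X_B, 𝓕_B)`, dual sections, evaluation pairing

[MumfordAV1970] §5 (p. 46) and §10 (p. 89), [GortzWedhorn2023] Thm. 24.66 — the RELATIVE edition of ★ `Motives/SeesawChartSections`
(M13 node N1, file S4): the ★ chain is typed over `SchemeOver ℂ`, but ★ `Motives.SchemeOver (k) [CommRing k] := Over (Spec k)` is
already over a commutative RING, and the chart vocabulary uses the field only through the Stein isomorphism
`B ⥲ Γ(X × Spec B, 𝒪)` (★ `snd_app_bijective_holds`).  Here `ℂ` is replaced by a commutative ring `R` (the affine base `Spec R` of a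
proper flat family `X → Spec R`, e.g. an abelian scheme `A_R`, and of the parameter scheme `W → Spec R`, e.g. `A_R` again for
`K(L)`; products `X ⊗ W = X ×_R W` in `SchemeOver R`), and the Stein input becomes the HYPOTHESIS `UnivStein X` («`Γ(V, 𝒪_T) ⥲
Γ(X ×_R V, 𝒪)` for every `R`-scheme `T` and open `V ⊆ T`», [GortzWedhorn2023] Cor. 24.63: flat proper with geometrically connected and
reduced fibres), discharged for abelian schemes over a locally Noetherian base by ★ `AbelianSchemeOver.baseChange_app_bijective`
(`AbelianSchemes/AbelianSchemeSteinOfNoetherian`) and for `R = ℂ`, `X` proper geometrically integral by ★ `snd_app_bijective_holds` — so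
this chain SPECIALISES to the absolute one.  Decl for decl the twin of ★ `SeesawChartSections` (same names, namespace
`Literature.AlgebraicGeometry.Motives.SeesawRelative`; the base-free helper ★ `SeesawSubscheme.isIso_presheaf_map_of_eq_top` is imported,
not copied):
* `specTest U B : SchemeOver R`, `specTestHom`, `specTestMap φ` (functorial in `φ : B →ₐ[A] C`, `A = Γ(W, U)`);
* `FB X 𝓕 U B` = `𝓕_B` on `X ×_R Spec B`, `Triv X 𝓕 U B` («`𝓕_B ≅ pr^*𝓜`, `𝓜` rank one quasi-coherent on `Spec B`»),
  `H0 X 𝓕 U B = Γ(X ×_R Spec B, 𝓕_B)` with its `B`-module structure through `toTopRing : B → Γ(X ×_R Spec B, 𝒪)` (bijective under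
  `UnivStein X`: `toTopRing_bijective`), `FBIso`/`H0map`;
* `DualSec`, `DualSecMap` (★ `pullbackDualIso`), `evalPair`, `baseChangeTop`, the base-change statement `brickN` for the pairing;
* `isIntegral_tensor_specTest` (Mathlib `GeometricallyIntegral.geometrically_isIntegral`, base-agnostic);
* the link plumbing `testRingHom`/`testAlgebra`/`specTestToS`/`sToSpecTest` (an affine test scheme `S → U ⊆ W` IS `Spec Γ(S, ⊤)` over `W`).
No theorem of substance; cell `hodgecm-mathlib` (D-0151), F-DAG price sheet v0.4 §5b hand (h8) «relative seesaw for `A ×_S A → A`»,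
file R1 of the port map `B-provers/B-p08/g11/PORTMAP-h8-RelativeSeesaw.B-p08g11.md` (author B-p08 (g11)).  HC_CM is proved only modulo the 7
printed citations until rung 0 closes; this file asserts nothing about HC.

## References
* [MumfordAV1970] D. Mumford, *Abelian Varieties* (1970), §5 p. 46, §10 p. 89.
* [GortzWedhorn2023] U. Görtz, T. Wedhorn, *Algebraic Geometry II* (2023), Thm. 24.66 (p. 405; proof pp. 407–408), Cor. 24.63.
* [Hartshorne1977] R. Hartshorne, *Algebraic Geometry* (1977), II Ex. 2.4, II Ex. 5.1 (b), (d).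
-/

set_option autoImplicit false

noncomputable section

-- `TopCat.Presheaf`/`Scheme.Modules` are not reducible (as in Mathlib's `AlgebraicGeometry/Modules`).
set_option backward.isDefEq.respectTransparency false

universe u

open CategoryTheory CategoryTheory.Limits AlgebraicGeometry MonoidalCategory CartesianMonoidalCategory
  Opposite

namespace Literature.AlgebraicGeometry.Motives

namespace SeesawRelative

open Literature.AlgebraicGeometry.Modules

variable {R : Type} [CommRing R] (X : SchemeOver R) {W : SchemeOver R} (𝓕 : (X ⊗ W).left.Modules)
  (U : W.left.affineOpens)


/-! ## §1 Test morphisms `Spec B → U ⊆ W` attached to `Γ(W, U)`-algebras -/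

/-- `Spec B → Spec Γ(W, U) ≅ U ⊆ W` for a `Γ(W, U)`-algebra `B` (non-Prop plumbing). [folklore] -/
abbrev specTestι (B : Type) [CommRing B] [Algebra Γ(W.left, U) B] : Spec (.of B) ⟶ W.left :=
  Spec.map (CommRingCat.ofHom (algebraMap Γ(W.left, U) B)) ≫ U.2.fromSpec

/-- `Spec B` as an `R`-scheme through the chart (non-Prop plumbing). [folklore] -/
abbrev specTest (B : Type) [CommRing B] [Algebra Γ(W.left, U) B] : SchemeOver R :=
  Over.mk (specTestι U B ≫ W.hom)

/-- The test morphism `u_B : Spec B → W` over `R` (non-Prop plumbing). [folklore] -/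
abbrev specTestHom (B : Type) [CommRing B] [Algebra Γ(W.left, U) B] : specTest U B ⟶ W :=
  Over.homMk (specTestι U B) rfl

/-- `Spec B` is affine (instance on the file's abbreviation). [folklore] -/
instance (B : Type) [CommRing B] [Algebra Γ(W.left, U) B] : IsAffine (specTest U B).left :=
  inferInstanceAs (IsAffine (Spec _))

/-- The test morphism lands in the chart `U`. [cite: MumfordAV1970, §10 (p. 89)] -/
theorem specTestι_preimage (B : Type) [CommRing B] [Algebra Γ(W.left, U) B] :
    specTestι U B ⁻¹ᵁ (U : W.left.Opens) = ⊤ := by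
  rw [Scheme.Hom.comp_preimage, U.2.fromSpec_preimage_self]
  rfl

/-- `Spec φ : Spec C → Spec B` over `W`, for a `Γ(W, U)`-algebra map `φ : B → C` (non-Prop plumbing). [folklore] -/
abbrev specTestMap {B C : Type} [CommRing B] [Algebra Γ(W.left, U) B] [CommRing C] [Algebra Γ(W.left, U) C]
    (φ : B →ₐ[Γ(W.left, U)] C) : specTest U C ⟶ specTest U B :=
  Over.homMk (Spec.map (CommRingCat.ofHom (φ : B →+* C))) (by
    change Spec.map _ ≫ (Spec.map _ ≫ _) ≫ W.hom = (Spec.map _ ≫ _) ≫ W.hom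
    rw [← Category.assoc, ← Category.assoc, ← Spec.map_comp, ← CommRingCat.ofHom_comp, φ.comp_algebraMap])

/-- `Spec φ` commutes with the test morphisms: `Spec C → Spec B → W` is `Spec C → W`. [cite: MumfordAV1970, §5 (p. 46)] -/
theorem specTestMap_comp {B C : Type} [CommRing B] [Algebra Γ(W.left, U) B] [CommRing C]
    [Algebra Γ(W.left, U) C] (φ : B →ₐ[Γ(W.left, U)] C) :
    specTestMap U φ ≫ specTestHom U B = specTestHom U C := by
  ext : 1
  change Spec.map _ ≫ Spec.map _ ≫ _ = Spec.map _ ≫ _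
  rw [← Category.assoc, ← Spec.map_comp, ← CommRingCat.ofHom_comp, φ.comp_algebraMap]

/-! ## §2 `Triv`, the pulled-back module `𝓕_B` and its global sections -/

/-- **`Triv B`**: `𝓕` pulled back along `1_X × u_B` is trivialised from the base `Spec B` (= the predicate
`TrivFromBase X 𝓕 (specTestHom U B)` of the global half `SeesawSubschemeReprIdeal`, unfolded so that the two files are
independent; they agree by `Iff.rfl`). [cite: MumfordAV1970, §10 (p. 89)] -/
def Triv (B : Type) [CommRing B] [Algebra Γ(W.left, U) B] : Prop :=
  ∃ (𝓜 : (specTest U B).left.Modules) (_ : 𝓜.IsQuasicoherent) (_ : HasRank 𝓜 1),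
    Nonempty ((Scheme.Modules.pullback (X ◁ specTestHom U B).left).obj 𝓕 ≅
      (Scheme.Modules.pullback (CartesianMonoidalCategory.snd X (specTest U B)).left).obj 𝓜)

/-- The module `𝓕_B := (1_X × u_B)^*𝓕` on `X × Spec B` (non-Prop plumbing). [cite: MumfordAV1970, §5 (p. 46)] -/
abbrev FB (B : Type) [CommRing B] [Algebra Γ(W.left, U) B] : (X ⊗ specTest U B).left.Modules :=
  (Scheme.Modules.pullback (X ◁ specTestHom U B).left).obj 𝓕

/-- **`H⁰(X × Spec B, 𝓕_B)`** — the global sections of `𝓕_B` (an additive group; non-Prop plumbing).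
[cite: MumfordAV1970, §5 (p. 46)] -/
abbrev H0 (B : Type) [CommRing B] [Algebra Γ(W.left, U) B] : Type :=
  Γ(FB X 𝓕 U B, (⊤ : (X ⊗ specTest U B).left.Opens))

/-- `(1 × Spec φ)^* 𝓕_B ≅ 𝓕_C` (pseudofunctoriality; non-Prop plumbing). [folklore] -/
def FBIso {B C : Type} [CommRing B] [Algebra Γ(W.left, U) B] [CommRing C] [Algebra Γ(W.left, U) C]
    (φ : B →ₐ[Γ(W.left, U)] C) :
    (Scheme.Modules.pullback (X ◁ specTestMap U φ).left).obj (FB X 𝓕 U B) ≅ FB X 𝓕 U C :=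
  (Scheme.Modules.pullbackComp (X ◁ specTestMap U φ).left (X ◁ specTestHom U B).left).app 𝓕 ≪≫
    (Scheme.Modules.pullbackCongr (by
      rw [← Over.comp_left, ← MonoidalCategory.whiskerLeft_comp, specTestMap_comp])).app 𝓕

/-- **`H⁰(φ) : H⁰(X_B, 𝓕_B) → H⁰(X_C, 𝓕_C)`**, the pull-back of global sections along `1 × Spec φ`
(non-Prop plumbing). [cite: MumfordAV1970, §5 (p. 46)] -/
def H0map {B C : Type} [CommRing B] [Algebra Γ(W.left, U) B] [CommRing C] [Algebra Γ(W.left, U) C]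
    (φ : B →ₐ[Γ(W.left, U)] C) : H0 X 𝓕 U B → H0 X 𝓕 U C := fun s =>
  ((FBIso X 𝓕 U φ).hom.app ⊤)
    (unitSection (X ◁ specTestMap U φ).left (FB X 𝓕 U B) ⊤ s)

/-! ## §3 The `B`-module structure on `H⁰(X_B, 𝓕_B)` -/

/-- `B → Γ(X × Spec B, 𝒪)`: the structure map of the second projection (non-Prop plumbing; an isomorphism
under `UnivStein X`, `toTopRing_bijective`). [cite: MumfordAV1970, §5 (p. 46)] -/
def toTopRing (B : Type) [CommRing B] [Algebra Γ(W.left, U) B] :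
    B →+* Γ((X ⊗ specTest U B).left, (⊤ : (X ⊗ specTest U B).left.Opens)) :=
  ((CartesianMonoidalCategory.snd X (specTest U B)).left.appTop).hom.comp
    (Scheme.ΓSpecIso (.of B)).inv.hom

/-- `H⁰(X_B, 𝓕_B)` as a `B`-module through `B → Γ(X_B, 𝒪)` (instance on the file-local abbrev `H0`;
inlined before any filing). [cite: MumfordAV1970, §5 (p. 46)] -/
instance instModuleH0 (B : Type) [CommRing B] [Algebra Γ(W.left, U) B] : Module B (H0 X 𝓕 U B) :=
  Module.compHom _ (toTopRing X U B)

/-- The `B`-action on `H⁰(X_B, 𝓕_B)` is through `toTopRing`. [cite: MumfordAV1970, §5 (p. 46)] -/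
theorem smul_H0_def (B : Type) [CommRing B] [Algebra Γ(W.left, U) B] (b : B) (s : H0 X 𝓕 U B) :
    b • s = toTopRing X U B b • s := rfl

/-! ## §4 Dual sections `Hom(𝓕_B|_⊤, 𝒪|_⊤)` and their base change -/

/-- `𝓕_B` has rank one (pull-back of a rank-one module). [cite: MumfordAV1970, §5 (p. 46)] -/
theorem hasRank_FB (h𝓕 : HasRank 𝓕 1) (B : Type) [CommRing B] [Algebra Γ(W.left, U) B] :
    HasRank (FB X 𝓕 U B) 1 :=
  hasRank_pullback _ h𝓕

/-- **Dual sections** `Γ(𝓕_B^∨, ⊤) = Hom(𝓕_B|_⊤, 𝒪|_⊤)` (non-Prop plumbing; = `H⁰(X_B, 𝓕_B⁻¹)`).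
[cite: MumfordAV1970, §10 (p. 89)] -/
abbrev DualSec (B : Type) [CommRing B] [Algebra Γ(W.left, U) B] : Type :=
  Γ(Modules.dual (FB X 𝓕 U B), (⊤ : (X ⊗ specTest U B).left.Opens))

/-- `Hom(𝓕_B|_⊤, 𝒪|_⊤)` as a `B`-module through `B → Γ(X_B, 𝒪)` (instance on a file-local abbrev).
[cite: MumfordAV1970, §5 (p. 46)] -/
instance instModuleDualSec (B : Type) [CommRing B] [Algebra Γ(W.left, U) B] : Module B (DualSec X 𝓕 U B) :=
  Module.compHom _ (toTopRing X U B)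

/-- The `B`-action on `Hom(𝓕_B|_⊤, 𝒪|_⊤)` is through `toTopRing`. [cite: MumfordAV1970, §5 (p. 46)] -/
theorem smul_DualSec_def (B : Type) [CommRing B] [Algebra Γ(W.left, U) B] (b : B) (μ : DualSec X 𝓕 U B) :
    b • μ = toTopRing X U B b • μ := rfl

/-- **The evaluation pairing** `μ(σ) ∈ Γ(X_B, 𝒪)` of a dual section and a section (non-Prop plumbing).
[cite: MumfordAV1970, §10 (p. 89)] -/
def evalPair (B : Type) [CommRing B] [Algebra Γ(W.left, U) B] (μ : DualSec X 𝓕 U B) (σ : H0 X 𝓕 U B) :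
    Γ((X ⊗ specTest U B).left, (⊤ : (X ⊗ specTest U B).left.Opens)) :=
  (appLE (μ : (FB X 𝓕 U B).over ⊤ ⟶ (unitModule (X ⊗ specTest U B).left).over ⊤) (𝟙 ⊤) σ :
    Γ(unitModule (X ⊗ specTest U B).left, (⊤ : (X ⊗ specTest U B).left.Opens)))

/-- **Base change of dual sections** along `φ : B → C`: pull back `μ ∈ Γ(𝓕_B^∨)` to `Γ((1 × Spec φ)^*𝓕_B^∨)`,
move through `f^*(E^∨) ≅ (f^*E)^∨` (★ `pullbackDualIso`) and along `𝓕_C ≅ (1 × Spec φ)^*𝓕_B` (`FBIso`)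
(non-Prop plumbing). [cite: Hartshorne1977, II Ex. 5.1 (b) and (d)] -/
def DualSecMap (h𝓕 : HasRank 𝓕 1) {B C : Type} [CommRing B] [Algebra Γ(W.left, U) B] [CommRing C]
    [Algebra Γ(W.left, U) C] (φ : B →ₐ[Γ(W.left, U)] C) : DualSec X 𝓕 U B → DualSec X 𝓕 U C := fun μ =>
  ((sheafHomMapLeft (FBIso X 𝓕 U φ).inv (unitModule (X ⊗ specTest U C).left)).app ⊤)
    (((pullbackDualIso (X ◁ specTestMap U φ).left (HasRank.isFiniteLocallyFree' (hasRank_FB X 𝓕 U h𝓕 B))).hom.app ⊤)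
      (unitSection (X ◁ specTestMap U φ).left (Modules.dual (FB X 𝓕 U B)) ⊤ μ))

/-! ## §5 Base change of the evaluation pairing (statement) -/

/-- `Γ(X_B, 𝒪) → Γ(X_C, 𝒪)` along `φ : B → C` (non-Prop plumbing). [folklore] -/
abbrev baseChangeTop {B C : Type} [CommRing B] [Algebra Γ(W.left, U) B] [CommRing C] [Algebra Γ(W.left, U) C]
    (φ : B →ₐ[Γ(W.left, U)] C) :
    Γ((X ⊗ specTest U B).left, (⊤ : (X ⊗ specTest U B).left.Opens)) →+*
      Γ((X ⊗ specTest U C).left, (⊤ : (X ⊗ specTest U C).left.Opens)) :=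
  ((X ◁ specTestMap U φ).left.appTop).hom

/-- **Brick (N), the statement** — the evaluation pairing commutes with base change:
`μ_C(σ_C) = (1 × Spec φ)^♯ (μ_B(σ_B))` for `σ_C := H⁰(φ) σ`, `μ_C := DualSecMap φ μ` (generic form: for
`f : Y′ ⟶ Y`, `appLE (f^*μ) (𝟙 ⊤) (η σ) = f^♯ (appLE μ (𝟙 ⊤) σ)` through ★ `pullbackDualIso`; plus the `FBIso`
cancellation); proved as `brickN_holds` in `SeesawChartFibreCyclic`. [cite: Hartshorne1977, II Ex. 5.1 (d)] -/
def brickN (h𝓕 : HasRank 𝓕 1) : Prop :=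
  ∀ (B C : Type) [CommRing B] [Algebra Γ(W.left, U) B] [CommRing C] [Algebra Γ(W.left, U) C]
    (φ : B →ₐ[Γ(W.left, U)] C) (σ : H0 X 𝓕 U B) (μ : DualSec X 𝓕 U B),
    evalPair X 𝓕 U C (DualSecMap X 𝓕 U h𝓕 φ μ) (H0map X 𝓕 U φ σ) = baseChangeTop X U φ (evalPair X 𝓕 U B μ σ)


/-! ## The coefficient field of the fibres: `Γ(X × Spec B, 𝒪) = B` and integrality over fields -/

section ProperGeometricallyIntegral

variable {U} in
/-- **`X → Spec R` is UNIVERSALLY STEIN**: for every `R`-scheme `T` and every open `V ⊆ T`, the structure map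
`Γ(V, 𝒪_T) → Γ(X ×_R V, 𝒪)` of the second projection is bijective ([GortzWedhorn2023] Cor. 24.63: holds for `X → Spec R` flat,
proper, of finite presentation with geometrically connected and geometrically reduced fibres; ★ `snd_app_bijective_holds` is the case
`R` a field, `X` proper geometrically integral; ★ `AbelianSchemeOver.baseChange_app_bijective` the case of an abelian scheme over a
locally Noetherian base) — the ONE hypothesis replacing the field in the relative seesaw chain.
[cite: GortzWedhorn2023, Cor. 24.63] -/
def UnivStein (X : SchemeOver R) : Prop :=
  ∀ (T : SchemeOver R) (V : T.left.Opens), Function.Bijective ((CartesianMonoidalCategory.snd X T).left.app V)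

variable {X U} in
/-- `B → Γ(X ×_R Spec B, 𝒪)` is bijective under `UnivStein X`. [cite: GortzWedhorn2023, Cor. 24.63] -/
theorem toTopRing_bijective (hSt : UnivStein X) (B : Type) [CommRing B] [Algebra Γ(W.left, U) B] :
    Function.Bijective (toTopRing X U B) :=
  (hSt (specTest U B) ⊤).comp (ConcreteCategory.bijective_of_isIso (Scheme.ΓSpecIso (.of B)).inv)

variable [GeometricallyIntegral X.hom]

/-- `X × Spec K` is integral for a field `K` (geometric integrality of `X/R`). [cite: GortzWedhorn2020, Prop. 5.51] -/
theorem isIntegral_tensor_specTest (K : Type) [Field K] [Algebra Γ(W.left, U) K] :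
    IsIntegral (X ⊗ specTest U K).left :=
  GeometricallyIntegral.geometrically_isIntegral (f := X.hom) (specTest U K).hom
    (pullback.fst X.hom (specTest U K).hom) (pullback.snd X.hom (specTest U K).hom)
    (IsPullback.of_hasPullback X.hom (specTest U K).hom)

end ProperGeometricallyIntegral

/-! ## The link plumbing: an affine test scheme `S → U ⊆ W` is `Spec Γ(S, ⊤)` over `W` -/

section Link

variable {S : SchemeOver R} (u : S ⟶ W) (hu : u.left ⁻¹ᵁ (U : W.left.Opens) = ⊤)

/-- The comparison ring map `Γ(W, U) → Γ(S, ⊤)` of an affine test morphism landing in `U`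
(non-Prop plumbing). [folklore] -/
def testRingHom : Γ(W.left, U) ⟶ Γ(S.left, (⊤ : S.left.Opens)) :=
  u.left.appLE U ⊤ (by rw [hu])

/-- `Γ(S, ⊤)` as a `Γ(W, U)`-algebra through the test morphism (non-Prop plumbing; a local instance). [folklore] -/
@[reducible] def testAlgebra : Algebra Γ(W.left, U) Γ(S.left, (⊤ : S.left.Opens)) :=
  (testRingHom U u hu).hom.toAlgebra

/-- The kernel of `Γ(W, U) → Γ(S, u⁻¹U)` is that of `Γ(W, U) → Γ(S, ⊤)` (the two differ by an invertible
restriction). [cite: MumfordAV1970, §10 (p. 89)] -/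
theorem ker_app_eq_ker_testRingHom :
    RingHom.ker (u.left.app U).hom = RingHom.ker (testRingHom U u hu).hom := by
  haveI := SeesawSubscheme.isIso_presheaf_map_of_eq_top hu rfl
    (homOfLE (show (⊤ : S.left.Opens) ≤ u.left ⁻¹ᵁ (U : W.left.Opens) by rw [hu]))
  have hinj : Function.Injective (S.left.presheaf.map
      (homOfLE (show (⊤ : S.left.Opens) ≤ u.left ⁻¹ᵁ (U : W.left.Opens) by rw [hu])).op).hom :=
    (ConcreteCategory.bijective_of_isIso _).1
  ext x
  simp only [RingHom.mem_ker]
  change _ ↔ (S.left.presheaf.map (homOfLE _).op).hom ((u.left.app U).hom x) = 0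
  rw [map_eq_zero_iff _ hinj]

/-- The affine test scheme is `Spec Γ(S, ⊤)` over `W`: `Spec(Γ(W,U) → Γ(S,⊤)) ≫ (U ↪ W) = (Spec Γ(S,⊤) ≅ S) ≫ u`.
[cite: Hartshorne1977, II Ex. 2.4] -/
theorem specMap_testRingHom_fromSpec [IsAffine S.left] :
    Spec.map (testRingHom U u hu) ≫ U.2.fromSpec = (isAffineOpen_top S.left).fromSpec ≫ u.left :=
  IsAffineOpen.SpecMap_appLE_fromSpec u.left U.2 (isAffineOpen_top S.left) _

/-- The comparison `Spec Γ(S, ⊤) → S` over `R`, from the test scheme of `Γ(S, ⊤)` (non-Prop plumbing). [folklore] -/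
def specTestToS [IsAffine S.left] :
    (letI := testAlgebra U u hu; specTest U Γ(S.left, (⊤ : S.left.Opens))) ⟶ S :=
  letI := testAlgebra U u hu
  Over.homMk (isAffineOpen_top S.left).fromSpec (by
    change (isAffineOpen_top S.left).fromSpec ≫ S.hom = (Spec.map _ ≫ U.2.fromSpec) ≫ W.hom
    rw [← Over.w u, ← Category.assoc, ← specMap_testRingHom_fromSpec U u hu]
    rfl)

/-- `(Spec Γ(S, ⊤) → S) ≫ u` is the test morphism of the `Γ(W, U)`-algebra `Γ(S, ⊤)`. [cite: Hartshorne1977, II Ex. 2.4] -/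
theorem specTestToS_comp [IsAffine S.left] :
    letI := testAlgebra U u hu
    specTestToS U u hu ≫ u = specTestHom U Γ(S.left, (⊤ : S.left.Opens)) := by
  letI := testAlgebra U u hu
  ext : 1
  change (isAffineOpen_top S.left).fromSpec ≫ u.left = Spec.map _ ≫ U.2.fromSpec
  rw [← specMap_testRingHom_fromSpec U u hu]
  rfl

/-- The inverse comparison `S → Spec Γ(S, ⊤)` over `R` (non-Prop plumbing). [folklore] -/
def sToSpecTest [IsAffine S.left] :
    S ⟶ (letI := testAlgebra U u hu; specTest U Γ(S.left, (⊤ : S.left.Opens))) :=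
  letI := testAlgebra U u hu
  haveI : IsIso (isAffineOpen_top S.left).fromSpec := by
    rw [← IsAffineOpen.isoSpec_inv_ι]
    haveI : IsIso (Scheme.Opens.ι (⊤ : S.left.Opens)) := (inferInstance : IsIso S.left.topIso.hom)
    infer_instance
  Over.homMk (inv (isAffineOpen_top S.left).fromSpec) (by
    change inv (isAffineOpen_top S.left).fromSpec ≫ (Spec.map _ ≫ U.2.fromSpec) ≫ W.hom = S.hom
    rw [IsIso.inv_comp_eq, ← Over.w u, ← Category.assoc, ← specMap_testRingHom_fromSpec U u hu,
      Category.assoc]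
    rfl)

/-- `(S → Spec Γ(S, ⊤)) ≫ u_{Γ(S,⊤)} = u`. [cite: Hartshorne1977, II Ex. 2.4] -/
theorem sToSpecTest_comp [IsAffine S.left] :
    letI := testAlgebra U u hu
    sToSpecTest U u hu ≫ specTestHom U Γ(S.left, (⊤ : S.left.Opens)) = u := by
  letI := testAlgebra U u hu
  haveI : IsIso (isAffineOpen_top S.left).fromSpec := by
    rw [← IsAffineOpen.isoSpec_inv_ι]
    haveI : IsIso (Scheme.Opens.ι (⊤ : S.left.Opens)) := (inferInstance : IsIso S.left.topIso.hom)
    infer_instance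
  ext : 1
  change inv (isAffineOpen_top S.left).fromSpec ≫ (Spec.map _ ≫ U.2.fromSpec) = u.left
  rw [IsIso.inv_comp_eq]
  exact (specMap_testRingHom_fromSpec U u hu)

end Link

end SeesawRelative

end Literature.AlgebraicGeometry.Motives

end
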